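import Literature.AnabelianGeometry.EtaleTheta.FrobenioidThetaDivisorSupportR
import Literature.AnabelianGeometry.EtaleTheta.Discharge.Sec5Prop53Surjection
import Mathlib.Algebra.Group.Submonoid.Membership

/-!
# [EtTh] §5, Proposition 5.3 (ii)–(v) over the REPAIRED divisor-support vocabulary (pp. 325–327 / PDF pp. 99–101)

Mochizuki, *The étale theta function …*, Publ. RIMS **45** (2009)
[cite: MochizukiEtTh2009, Prop 5.3 p.325 (PDF p.99); proof p.326–327 (PDF pp.100–101)].  Seat abc-iut-L2-d4 (merge row
W3-L2-03); PROOF-ONLY port of this seat's `Discharge/Sec5Prop53Labels.lean` / `…MonoidType.lean` / `…Surjection.lean`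
(p420498 / p420833 / p420906 — correct but VACUOUS, their carrier `DivisorSupportData` being uninhabited: finding
F-L6d1g3-1 of abc-iut-L6-d1, certificate `FrobenioidThetaDivisorSupportNegative.lean` p420948) to abc-iut-L6-d1's REPAIR OF
RECORD `FrobenioidThetaDivisorSupportR.lean` (`DivisorSupportData'`: the factorization homomorphism is PRODUCT-valued,
[EtTh] Prop. 3.2 (i) p.296 (PDF p.70), so that log-divisors of infinite support — `div(Θ̈)`, `div(U)` — exist).

What changes in the proofs: the compatibility of a monoid automorphism `ψ` of `Φ(A_⊚)` with the orders
(`ordOf'_map`) can no longer use a common denominator of finitely many coordinates; it is now derived from the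
[FrdI] Def. 2.4 (i)(c) sup-characterisation carried by the repaired data (`le_ord_iff`: `n ≤ m·ord_𝔭(a)` iff
`gen_𝔭^n ∣ a^m`) — `ψ` preserves divisibility, powers and prime log-divisors (`map_gen'`), and a non-negative rational
is determined by the set of fractions below it (`eq_of_forall_natCast_le_mul_iff`).  Everything else transports as
before (supports — possibly infinite —, their cardinalities and finiteness, linear equivalence, cuspidality,
cuspidal minimality with its finite-support competitor clause, coprimality), and "monoid type `ℤ`" is again a theorem
(`monoidTypeZ'`).  RESULTS: Prop. 5.3 (ii), (iii) for data carrying a `DivisorSupportData'` given (i) on primes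
(`preservesNcspComponentIsos_of_supportData'`, `preservesCspComponentIsos_of_supportData'`); Prop. 5.3 (v) modulo (i),
F1-Ψ and the printed adjacency criterion `AdjacencyCriterion'` (`preservesNcspLabels_of_supportData'`); Prop. 5.3 (iv)
modulo (i), F1-Ψ and the printed description `CspToNcspWitnessed'`/`CspToNcspCriterion'`
(`preservesCspToNcsp_of_criterion'`).  The criteria themselves are abc-iut-L6-d1's row (G-L2d4-2, from the binder
`PrincipalIffDegreeZero`).
HONEST FRAMING: kernel-checked implications; (i), F1-Ψ and the printed criteria enter as hypotheses; typed ≠ discharged;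
no side taken on anything downstream. -/

namespace Literature.AnabelianGeometry.EtaleTheta

open CategoryTheory
open Literature.AlgebraicGeometry.Frobenioids

universe w v v' u u'

/-- A non-negative rational is determined by the fractions `n/m` not exceeding it ([FrdI] Def. 2.4 (i)(c): the
coordinate of the factorization is a supremum).  [cite: MochizukiFrdI2008, Def. 2.4(i) p.47] -/
theorem eq_of_forall_natCast_le_mul_iff {r s : ℚ} (hr : 0 ≤ r) (hs : 0 ≤ s)
    (h : ∀ n m : ℕ, 0 < m → ((n : ℚ) ≤ m * r ↔ (n : ℚ) ≤ m * s)) : r = s := by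
  -- a fraction strictly between two distinct non-negative rationals violates `h`
  have key : ∀ {r s : ℚ}, 0 ≤ r → (∀ n m : ℕ, 0 < m → ((n : ℚ) ≤ m * r ↔ (n : ℚ) ≤ m * s)) → ¬ r < s := by
    intro r s hr h hlt
    set q : ℚ := (r + s) / 2 with hq
    have hrq : r < q := by rw [hq]; linarith
    have hqs : q < s := by rw [hq]; linarith
    have hq0 : 0 ≤ q := hr.trans hrq.le
    have hnum : 0 ≤ q.num := Rat.num_nonneg.mpr hq0
    have hcast : ((q.num.toNat : ℕ) : ℚ) = (q.num : ℚ) := by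
      rw [← Int.cast_natCast, Int.toNat_of_nonneg hnum]
    have hqm : ((q.num.toNat : ℕ) : ℚ) = q.den * q := by rw [hcast, Rat.den_mul_eq_num]
    have hdpos : (0 : ℚ) < q.den := by exact_mod_cast q.den_pos
    have h2 : ((q.num.toNat : ℕ) : ℚ) ≤ q.den * s := by
      rw [hqm]; exact mul_le_mul_of_nonneg_left hqs.le hdpos.le
    have h1 : ((q.num.toNat : ℕ) : ℚ) ≤ q.den * r := (h q.num.toNat q.den q.den_pos).mpr h2
    rw [hqm] at h1
    exact absurd (le_of_mul_le_mul_left h1 hdpos) (not_le.mpr hrq)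
  rcases lt_trichotomy r s with hlt | heq | hgt
  · exact absurd hlt (key hr h)
  · exact heq
  · exact absurd hgt (key hs fun n m hm => (h n m hm).symm)

namespace FrobenioidThetaDivisors

namespace DivisorSupportData'

variable {C : Type u} [Category.{v} C] {D : Type u'} [Category.{v'} D] {𝔉 : ThetaFrobenioid.{w} C D}
  {𝔓 : DivisorPrimeData 𝔉}

/-! ### Prime log-divisors generate the primary components -/

/-- `ord_𝔭(gen_𝔭^n) = n`. [cite: MochizukiEtTh2009, Prop 5.3 p.325 (PDF p.99)] -/
theorem factor_gen_pow_self (𝔖 : DivisorSupportData' 𝔓) (𝔭 : Primes 𝔉.PhiAcirc) (n : ℕ) :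
    𝔖.factor (𝔖.gen 𝔭 ^ n) 𝔭 = Multiplicative.ofAdd (n : ℚ) := by
  rw [map_pow, Pi.pow_apply, 𝔖.factor_gen_self, ← ofAdd_nsmul, nsmul_eq_mul, mul_one]

/-- `ord_𝔮(gen_𝔭^n) = 0` for `𝔮 ≠ 𝔭`. [cite: MochizukiEtTh2009, Prop 5.3 p.325 (PDF p.99)] -/
theorem factor_gen_pow_of_ne (𝔖 : DivisorSupportData' 𝔓)
    {𝔭 𝔮 : Primes 𝔉.PhiAcirc} (h : 𝔮 ≠ 𝔭) (n : ℕ) : 𝔖.factor (𝔖.gen 𝔭 ^ n) 𝔮 = 1 := by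
  rw [map_pow, Pi.pow_apply, 𝔖.factor_gen_of_ne h, one_pow]

/-- A primary element of `𝔭` is a positive power of the prime log-divisor `gen_𝔭`.
[cite: MochizukiEtTh2009, Prop 5.3 p.325 (PDF p.99)] -/
theorem eq_gen_pow_of_mem_carrier (𝔖 : DivisorSupportData' 𝔓)
    {𝔭 : Primes 𝔉.PhiAcirc} {a : 𝔉.PhiAcirc} (ha : a ∈ 𝔭.carrier) :
    ∃ n : ℕ, 0 < n ∧ a = 𝔖.gen 𝔭 ^ n := by
  obtain ⟨n, hn, h𝔭, hne⟩ := (𝔖.factor_carrier 𝔭 a).mp ha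
  refine ⟨n, hn, 𝔖.factor_injective (funext fun 𝔮 => ?_)⟩
  by_cases h : 𝔮 = 𝔭
  · subst h; rw [h𝔭, factor_gen_pow_self]
  · rw [hne 𝔮 h, 𝔖.factor_gen_pow_of_ne h]

/-- Positive powers of `gen_𝔭` are primary elements of `𝔭`. [cite: MochizukiEtTh2009, Prop 5.3 p.325 (PDF p.99)] -/
theorem gen_pow_mem_carrier (𝔖 : DivisorSupportData' 𝔓)
    (𝔭 : Primes 𝔉.PhiAcirc) {n : ℕ} (hn : 0 < n) : 𝔖.gen 𝔭 ^ n ∈ 𝔭.carrier :=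
  (𝔖.factor_carrier 𝔭 _).mpr ⟨n, hn, 𝔖.factor_gen_pow_self 𝔭 n, fun _ h => 𝔖.factor_gen_pow_of_ne h n⟩

/-- `gen_𝔭` is a primary element of `𝔭`. [cite: MochizukiEtTh2009, Prop 5.3 p.325 (PDF p.99)] -/
theorem gen_mem_carrier' (𝔖 : DivisorSupportData' 𝔓) (𝔭 : Primes 𝔉.PhiAcirc) : 𝔖.gen 𝔭 ∈ 𝔭.carrier := by
  simpa using 𝔖.gen_pow_mem_carrier 𝔭 one_pos

/-- **A monoid automorphism of `Φ(A_⊚)` maps prime log-divisors to prime log-divisors**: `ψ(gen_𝔭) = gen_{ψ𝔭}`.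
[cite: MochizukiEtTh2009, Prop 5.3 p.325 (PDF p.99)] -/
theorem map_gen' (𝔖 : DivisorSupportData' 𝔓) (ψ : 𝔉.PhiAcirc ≃* 𝔉.PhiAcirc) (𝔭 : Primes 𝔉.PhiAcirc) :
    ψ (𝔖.gen 𝔭) = 𝔖.gen (Primes.congr ψ 𝔭) := by
  have h1 : ψ (𝔖.gen 𝔭) ∈ (Primes.congr ψ 𝔭).carrier := by
    rw [Primes.carrier_congr]; exact ⟨_, 𝔖.gen_mem_carrier' 𝔭, rfl⟩
  obtain ⟨n₁, hn₁, h₁⟩ := 𝔖.eq_gen_pow_of_mem_carrier h1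
  have h2 : ψ.symm (𝔖.gen (Primes.congr ψ 𝔭)) ∈ 𝔭.carrier :=
    (Primes.mem_carrier_congr_iff ψ 𝔭 _).mp (𝔖.gen_mem_carrier' _)
  obtain ⟨n₂, hn₂, h₂⟩ := 𝔖.eq_gen_pow_of_mem_carrier h2
  have h3 : 𝔖.gen (Primes.congr ψ 𝔭) = 𝔖.gen (Primes.congr ψ 𝔭) ^ (n₁ * n₂) := by
    calc 𝔖.gen (Primes.congr ψ 𝔭) = ψ (ψ.symm (𝔖.gen (Primes.congr ψ 𝔭))) := (ψ.apply_symm_apply _).symm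
      _ = ψ (𝔖.gen 𝔭 ^ n₂) := by rw [h₂]
      _ = ψ (𝔖.gen 𝔭) ^ n₂ := map_pow _ _ _
      _ = 𝔖.gen (Primes.congr ψ 𝔭) ^ (n₁ * n₂) := by rw [h₁, ← pow_mul]
  have h4 : ((n₁ * n₂ : ℕ) : ℚ) = 1 := by
    have := congrArg (fun x => Multiplicative.toAdd (𝔖.factor x (Primes.congr ψ 𝔭))) h3
    simp only [factor_gen_pow_self, 𝔖.factor_gen_self, toAdd_ofAdd] at this
    exact this.symm
  have h5 : n₁ * n₂ = 1 := by exact_mod_cast h4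
  rw [h₁, Nat.eq_one_of_mul_eq_one_right h5, pow_one]

/-- **`Ψ^Φ_{A_⊚}` is compatible with the orders**, support-free: `ord_{ψ𝔭}(ψ a) = ord_𝔭(a)` for every monoid
automorphism `ψ` — by the sup-characterisation `le_ord_iff` ([FrdI] Def. 2.4 (i)(c)), since `ψ` preserves divisibility,
powers and prime log-divisors.  [cite: MochizukiEtTh2009, Prop 5.3 p.325 (PDF p.99)] -/
theorem ordOf'_map (𝔖 : DivisorSupportData' 𝔓)
    (ψ : 𝔉.PhiAcirc ≃* 𝔉.PhiAcirc) (𝔭 : Primes 𝔉.PhiAcirc) (a : 𝔉.PhiAcirc) :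
    ordOf' 𝔖.factor (Primes.congr ψ 𝔭) (ψ a) = ordOf' 𝔖.factor 𝔭 a := by
  change 𝔖.factor (ψ a) (Primes.congr ψ 𝔭) = 𝔖.factor a 𝔭
  apply Multiplicative.toAdd.injective
  refine eq_of_forall_natCast_le_mul_iff (𝔖.factor_nonneg _ _) (𝔖.factor_nonneg _ _) fun n m hm => ?_
  rw [𝔖.le_ord_iff _ _ n m hm, 𝔖.le_ord_iff _ _ n m hm, ← 𝔖.map_gen' ψ 𝔭, ← map_pow, ← map_pow]
  constructor
  · intro hd
    have := map_dvd ψ.symm hd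
    rwa [ψ.symm_apply_apply, ψ.symm_apply_apply] at this
  · exact map_dvd ψ

/-! ### Transport to `Φ(A_⊚)^gp` -/

variable (ψ : 𝔉.PhiAcirc ≃* 𝔉.PhiAcirc)

/-- The order on `Φ(A_⊚)^gp` extends the order on `Φ(A_⊚)`. [cite: MochizukiEtTh2009, Prop 5.3 proof p.326 (PDF p.100)] -/
theorem ordGp_of' (𝔖 : DivisorSupportData' 𝔓) (𝔭 : Primes 𝔉.PhiAcirc) (a : 𝔉.PhiAcirc) :
    𝔖.ordGp 𝔭 (Algebra.GrothendieckGroup.of a) = ordOf' 𝔖.factor 𝔭 a := by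
  have h := Algebra.GrothendieckGroup.lift.symm_apply_apply (ordOf' 𝔖.factor 𝔭)
  rw [Algebra.GrothendieckGroup.lift_symm_apply] at h
  exact DFunLike.congr_fun h a

/-- The orders on `Φ(A_⊚)^gp` are transported: `ord_{ψ𝔭}(ψ^gp x) = ord_𝔭(x)`.
[cite: MochizukiEtTh2009, Prop 5.3 proof p.326 (PDF p.100)] -/
theorem ordGp_gpMap' (𝔖 : DivisorSupportData' 𝔓) (𝔭 : Primes 𝔉.PhiAcirc) (x : Algebra.GrothendieckGroup 𝔉.PhiAcirc) :
    𝔖.ordGp (Primes.congr ψ 𝔭) (ThetaFrobenioid.gpMap ψ.toMonoidHom x) = 𝔖.ordGp 𝔭 x := by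
  have : (𝔖.ordGp (Primes.congr ψ 𝔭)).comp (ThetaFrobenioid.gpMap ψ.toMonoidHom) = 𝔖.ordGp 𝔭 :=
    DivisorSupportData.gpHom_ext fun a => by
      rw [MonoidHom.comp_apply, ThetaFrobenioid.gpMap_of, ordGp_of', MulEquiv.coe_toMonoidHom, ordGp_of']
      exact 𝔖.ordOf'_map ψ 𝔭 a
  exact DFunLike.congr_fun this x

/-- Supports (possibly infinite) are transported: `supp(ψ^gp x) = ψ(supp x)`.
[cite: MochizukiEtTh2009, Prop 5.3 proof p.326 (PDF p.100)] -/
theorem supp_gpMap' (𝔖 : DivisorSupportData' 𝔓) (x : Algebra.GrothendieckGroup 𝔉.PhiAcirc) :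
    suppOf' 𝔖.factor (ThetaFrobenioid.gpMap ψ.toMonoidHom x) = Primes.congr ψ '' suppOf' 𝔖.factor x := by
  ext 𝔮
  constructor
  · intro h
    refine ⟨Primes.congr ψ.symm 𝔮, ?_, Primes.congr_apply_congr_symm ψ 𝔮⟩
    change 𝔖.ordGp (Primes.congr ψ.symm 𝔮) x ≠ 1
    rw [← 𝔖.ordGp_gpMap' ψ (Primes.congr ψ.symm 𝔮) x, Primes.congr_apply_congr_symm]
    exact h
  · rintro ⟨𝔭, h𝔭, rfl⟩
    change 𝔖.ordGp (Primes.congr ψ 𝔭) _ ≠ 1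
    rw [𝔖.ordGp_gpMap']
    exact h𝔭

/-- Cardinalities of supports are preserved. [cite: MochizukiEtTh2009, Prop 5.3 proof p.326 (PDF p.100)] -/
theorem ncard_supp_gpMap' (𝔖 : DivisorSupportData' 𝔓) (x : Algebra.GrothendieckGroup 𝔉.PhiAcirc) :
    (suppOf' 𝔖.factor (ThetaFrobenioid.gpMap ψ.toMonoidHom x)).ncard = (suppOf' 𝔖.factor x).ncard := by
  rw [supp_gpMap', Set.ncard_image_of_injective _ (Primes.congr ψ).injective]

/-- Finiteness of supports is preserved. [cite: MochizukiEtTh2009, Prop 5.3 proof p.326 (PDF p.100)] -/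
theorem finite_supp_gpMap_iff' (𝔖 : DivisorSupportData' 𝔓) (x : Algebra.GrothendieckGroup 𝔉.PhiAcirc) :
    (suppOf' 𝔖.factor (ThetaFrobenioid.gpMap ψ.toMonoidHom x)).Finite ↔ (suppOf' 𝔖.factor x).Finite := by
  rw [supp_gpMap']
  exact Set.finite_image_iff (Primes.congr ψ).injective.injOn

/-- Linear equivalence is transported, given that `(Ψ^Φ_{A_⊚})^gp` preserves the principal elements (F1-Ψ).
[cite: MochizukiEtTh2009, Prop 5.3 proof p.326 (PDF p.100)] -/
theorem linEquiv_gpMap_iff' (𝔖 : DivisorSupportData' 𝔓)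
    (hP : ∀ x, ThetaFrobenioid.gpMap ψ.toMonoidHom x ∈ 𝔖.principal ↔ x ∈ 𝔖.principal)
    (x y : Algebra.GrothendieckGroup 𝔉.PhiAcirc) :
    𝔖.LinEquiv (ThetaFrobenioid.gpMap ψ.toMonoidHom x) (ThetaFrobenioid.gpMap ψ.toMonoidHom y) ↔
      𝔖.LinEquiv x y := by
  change _ ∈ 𝔖.principal ↔ _ ∈ 𝔖.principal
  rw [← map_inv, ← map_mul, hP]

/-- Cuspidality of elements of `Φ(A_⊚)^gp` is transported, given Prop. 5.3 (i) on primes.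
[cite: MochizukiEtTh2009, Prop 5.3 (i) p.325 (PDF p.99)] -/
theorem isCuspidalGp_gpMap_iff' (𝔖 : DivisorSupportData' 𝔓)
    (hc : ∀ 𝔭, 𝔓.IsCuspidal (Primes.congr ψ 𝔭) ↔ 𝔓.IsCuspidal 𝔭)
    (x : Algebra.GrothendieckGroup 𝔉.PhiAcirc) :
    IsCuspidalGpOf' 𝔓 𝔖.factor (ThetaFrobenioid.gpMap ψ.toMonoidHom x) ↔ IsCuspidalGpOf' 𝔓 𝔖.factor x := by
  change (∀ 𝔭 ∈ suppOf' 𝔖.factor (ThetaFrobenioid.gpMap ψ.toMonoidHom x), 𝔓.IsCuspidal 𝔭) ↔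
    ∀ 𝔭 ∈ suppOf' 𝔖.factor x, 𝔓.IsCuspidal 𝔭
  rw [supp_gpMap', Set.forall_mem_image]
  exact forall₂_congr fun 𝔭 _ => hc 𝔭

/-- Coprimality is transported. [cite: MochizukiEtTh2009, Prop 5.3 proof p.326 (PDF p.100)] -/
theorem coprime_gpMap_iff' (𝔖 : DivisorSupportData' 𝔓) (x y : Algebra.GrothendieckGroup 𝔉.PhiAcirc) :
    CoprimeOf' 𝔖.factor (ThetaFrobenioid.gpMap ψ.toMonoidHom x) (ThetaFrobenioid.gpMap ψ.toMonoidHom y) ↔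
      CoprimeOf' 𝔖.factor x y := by
  change Disjoint (suppOf' 𝔖.factor _) (suppOf' 𝔖.factor _) ↔ Disjoint (suppOf' 𝔖.factor x) (suppOf' 𝔖.factor y)
  rw [𝔖.supp_gpMap', 𝔖.supp_gpMap']
  exact Set.disjoint_image_iff (Primes.congr ψ).injective

/-- **Cuspidal minimality is transported** (cuspidality, supports with their cardinalities and finiteness — also of
the competitors —, linear equivalence).  [cite: MochizukiEtTh2009, Prop 5.3 proof p.326 (PDF p.100)] -/
theorem isCuspidallyMinimal_gpMap_iff' (𝔖 : DivisorSupportData' 𝔓)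
    (hc : ∀ 𝔭, 𝔓.IsCuspidal (Primes.congr ψ 𝔭) ↔ 𝔓.IsCuspidal 𝔭)
    (hP : ∀ x, ThetaFrobenioid.gpMap ψ.toMonoidHom x ∈ 𝔖.principal ↔ x ∈ 𝔖.principal)
    (x : Algebra.GrothendieckGroup 𝔉.PhiAcirc) :
    𝔖.IsCuspidallyMinimal (ThetaFrobenioid.gpMap ψ.toMonoidHom x) ↔ 𝔖.IsCuspidallyMinimal x := by
  constructor
  · rintro ⟨h1, h2, h3⟩
    refine ⟨(𝔖.isCuspidalGp_gpMap_iff' ψ hc x).mp h1, (𝔖.finite_supp_gpMap_iff' ψ x).mp h2,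
      fun y hy hyf hyx => ?_⟩
    have := h3 (ThetaFrobenioid.gpMap ψ.toMonoidHom y) ((𝔖.isCuspidalGp_gpMap_iff' ψ hc y).mpr hy)
      ((𝔖.finite_supp_gpMap_iff' ψ y).mpr hyf) ((𝔖.linEquiv_gpMap_iff' ψ hP y x).mpr hyx)
    rwa [ncard_supp_gpMap', ncard_supp_gpMap'] at this
  · rintro ⟨h1, h2, h3⟩
    refine ⟨(𝔖.isCuspidalGp_gpMap_iff' ψ hc x).mpr h1, (𝔖.finite_supp_gpMap_iff' ψ x).mpr h2,
      fun y hy hyf hyx => ?_⟩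
    rw [← DivisorSupportData.gpMap_gpMap_symm ψ y] at hy hyf hyx ⊢
    have := h3 _ ((𝔖.isCuspidalGp_gpMap_iff' ψ hc _).mp hy) ((𝔖.finite_supp_gpMap_iff' ψ _).mp hyf)
      ((𝔖.linEquiv_gpMap_iff' ψ hP _ x).mp hyx)
    rwa [ncard_supp_gpMap', ncard_supp_gpMap']

/-! ### Monoid type `ℤ` from the repaired data -/

/-- `Φ(A_⊚)_𝔭` is the monoid of powers of `gen_𝔭`. [cite: MochizukiEtTh2009, Prop 5.3 p.325 (PDF p.99)] -/
theorem submonoid_eq_powers' (𝔖 : DivisorSupportData' 𝔓)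
    (𝔭 : Primes 𝔉.PhiAcirc) : 𝔭.submonoid = Submonoid.powers (𝔖.gen 𝔭) := by
  apply le_antisymm
  · refine Submonoid.closure_le.mpr fun a ha => ?_
    obtain ⟨n, -, rfl⟩ := 𝔖.eq_gen_pow_of_mem_carrier ha
    exact ⟨n, rfl⟩
  · rw [Submonoid.powers_eq_closure]
    exact Submonoid.closure_le.mpr (Set.singleton_subset_iff.mpr (Submonoid.subset_closure (𝔖.gen_mem_carrier' 𝔭)))

/-- The exponent of a power of `gen_𝔭` is determined. [cite: MochizukiEtTh2009, Prop 5.3 p.325 (PDF p.99)] -/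
theorem gen_pow_injective' (𝔖 : DivisorSupportData' 𝔓)
    (𝔭 : Primes 𝔉.PhiAcirc) : Function.Injective fun n : ℕ => 𝔖.gen 𝔭 ^ n := by
  intro m n h
  have := congrArg (fun x => Multiplicative.toAdd (𝔖.factor x 𝔭)) h
  simp only [factor_gen_pow_self, toAdd_ofAdd] at this
  exact_mod_cast this

/-- **"`C` is of monoid type `ℤ`"** for data carrying a `DivisorSupportData'`: `Φ(A_⊚)_𝔭 ≅ ℤ_{≥0}`.
[cite: MochizukiEtTh2009, Def 3.6 (i) p.302 (PDF p.76); Prop 5.3 p.325 (PDF p.99)] -/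
theorem monoidTypeZ' (𝔖 : DivisorSupportData' 𝔓)
    (𝔭 : Primes 𝔉.PhiAcirc) : Nonempty (𝔭.submonoid ≃* Multiplicative ℕ) := by
  classical
  exact ⟨(MulEquiv.submonoidCongr (𝔖.submonoid_eq_powers' 𝔭)).trans
    (Submonoid.powLogEquiv (𝔖.gen_pow_injective' 𝔭)).symm⟩

end DivisorSupportData'

/-! ### Proposition 5.3 (ii)–(v) over the repaired data -/

section Prop53R

variable {C : Type u} [Category.{v} C] {D : Type u'} [Category.{v'} D] {𝔉 : ThetaFrobenioid.{w} C D}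
  {𝔓 : DivisorPrimeData 𝔉} (Ψ : C ≌ C) (ι : Ψ.functor.obj 𝔉.Acirc ≅ 𝔉.Acirc)
  (e : 𝔉.PhiAcirc ≃* 𝔉.pre.Mon (𝔉.base.obj (Ψ.functor.obj 𝔉.Acirc)))

/-- **[EtTh] Proposition 5.3 (ii)** for data carrying a `DivisorSupportData'`, given (i) on primes.
[cite: MochizukiEtTh2009, Prop 5.3 (ii) p.325 (PDF p.99)] -/
theorem preservesNcspComponentIsos_of_supportData' (𝔖 : DivisorSupportData' 𝔓) (hc : CuspPreserved 𝔓 Ψ ι e) :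
    PreservesNcspComponentIsos 𝔓 Ψ ι e hc :=
  preservesNcspComponentIsos_of_monoidTypeZ 𝔓 Ψ ι e hc 𝔖.monoidTypeZ'

/-- **[EtTh] Proposition 5.3 (iii)** for data carrying a `DivisorSupportData'`, given (i) on primes.
[cite: MochizukiEtTh2009, Prop 5.3 (iii) p.325 (PDF p.99)] -/
theorem preservesCspComponentIsos_of_supportData' (𝔖 : DivisorSupportData' 𝔓) (hc : CuspPreserved 𝔓 Ψ ι e) :
    PreservesCspComponentIsos 𝔓 Ψ ι e hc :=
  preservesCspComponentIsos_of_monoidTypeZ 𝔓 Ψ ι e hc 𝔖.monoidTypeZ'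

/-- **The adjacency of non-cuspidal primes is preserved by `Ψ^Φ_{A_⊚}`** — from the printed criterion
(`AdjacencyCriterion'`), Prop. 5.3 (i) on primes and F1-Ψ, over the repaired data (p.327 (PDF p.101)).
[cite: MochizukiEtTh2009, Prop 5.3 proof p.327 (PDF p.101)] -/
theorem adjacency_preserved_of_criterion' (𝔖 : DivisorSupportData' 𝔓) (hc : CuspPreserved 𝔓 Ψ ι e)
    (hP : ∀ x, ThetaFrobenioid.gpMap (psiPhi 𝔉 Ψ ι e).toMonoidHom x ∈ 𝔖.principal ↔ x ∈ 𝔖.principal)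
    (hAdj : AdjacencyCriterion' 𝔖) (𝔭 𝔮 : Primes 𝔉.PhiAcirc) (h𝔭 : ¬ 𝔓.IsCuspidal 𝔭) (h𝔮 : ¬ 𝔓.IsCuspidal 𝔮)
    (hadj : |𝔓.ncspEquivZ ⟨𝔭, h𝔭⟩ - 𝔓.ncspEquivZ ⟨𝔮, h𝔮⟩| = 1) :
    |𝔓.ncspEquivZ ⟨Primes.congr (psiPhi 𝔉 Ψ ι e) 𝔭, fun h => h𝔭 ((hc 𝔭).mp h)⟩ -
        𝔓.ncspEquivZ ⟨Primes.congr (psiPhi 𝔉 Ψ ι e) 𝔮, fun h => h𝔮 ((hc 𝔮).mp h)⟩| = 1 := by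
  set ψ := psiPhi 𝔉 Ψ ι e with hψ
  have hne : 𝔭 ≠ 𝔮 := by
    rintro rfl
    rw [sub_self, abs_zero] at hadj
    exact zero_ne_one hadj
  have h𝔭' : ¬ 𝔓.IsCuspidal (Primes.congr ψ 𝔭) := fun h => h𝔭 ((hc 𝔭).mp h)
  have h𝔮' : ¬ 𝔓.IsCuspidal (Primes.congr ψ 𝔮) := fun h => h𝔮 ((hc 𝔮).mp h)
  have hne' : Primes.congr ψ 𝔭 ≠ Primes.congr ψ 𝔮 := fun h => hne ((Primes.congr ψ).injective h)
  let a : 𝔭.submonoid := ⟨𝔖.gen 𝔭, Submonoid.subset_closure (𝔖.gen_mem_carrier' 𝔭)⟩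
  have ha : (a : 𝔉.PhiAcirc) ∈ 𝔭.carrier := 𝔖.gen_mem_carrier' 𝔭
  have H4 := (hAdj 𝔭 𝔮 h𝔭 h𝔮 hne a ha).1.mp hadj
  let a' : (Primes.congr ψ 𝔭).submonoid := Primes.submonoidCongr ψ 𝔭 _ rfl a
  have ha' : (a' : 𝔉.PhiAcirc) ∈ (Primes.congr ψ 𝔭).carrier := by
    rw [Primes.coe_submonoidCongr_apply, Primes.carrier_congr]
    exact ⟨_, ha, rfl⟩
  have hb' : (𝔓.ncspIso _ _ h𝔭' h𝔮' a' : 𝔉.PhiAcirc) = ψ (𝔓.ncspIso 𝔭 𝔮 h𝔭 h𝔮 a : 𝔉.PhiAcirc) :=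
    (apply_componentIso_eq ψ 𝔖.monoidTypeZ' 𝔭 𝔮 (𝔓.ncspIso 𝔭 𝔮 h𝔭 h𝔮) (𝔓.ncspIso _ _ h𝔭' h𝔮') a).symm
  refine (hAdj _ _ h𝔭' h𝔮' hne' a' ha').1.mpr fun c' hc' hlin => ?_
  have hcc : ThetaFrobenioid.gpMap ψ.toMonoidHom (ThetaFrobenioid.gpMap ψ.symm.toMonoidHom c') = c' :=
    DivisorSupportData.gpMap_gpMap_symm ψ c'
  rw [← hcc] at hc' hlin ⊢
  change (suppOf' 𝔖.factor _).ncard = 4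
  rw [𝔖.ncard_supp_gpMap']
  refine H4 _ ((𝔖.isCuspidallyMinimal_gpMap_iff' ψ hc hP _).mp hc') ?_
  have hab : Algebra.GrothendieckGroup.of (a' : 𝔉.PhiAcirc) *
      Algebra.GrothendieckGroup.of (𝔓.ncspIso _ _ h𝔭' h𝔮' a' : 𝔉.PhiAcirc) =
      ThetaFrobenioid.gpMap ψ.toMonoidHom (Algebra.GrothendieckGroup.of (a : 𝔉.PhiAcirc) *
        Algebra.GrothendieckGroup.of (𝔓.ncspIso 𝔭 𝔮 h𝔭 h𝔮 a : 𝔉.PhiAcirc)) := by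
    rw [map_mul, ThetaFrobenioid.gpMap_of, ThetaFrobenioid.gpMap_of, hb', Primes.coe_submonoidCongr_apply,
      MulEquiv.coe_toMonoidHom]
  rw [hab] at hlin
  exact (𝔖.linEquiv_gpMap_iff' ψ hP _ _).mp hlin

/-- **[EtTh] Proposition 5.3 (v) over the repaired data**, modulo (i) on primes, F1-Ψ and the printed adjacency
criterion only.  [cite: MochizukiEtTh2009, Prop 5.3 (v) p.325 (PDF p.99); proof p.327 (PDF p.101)] -/
theorem preservesNcspLabels_of_supportData' (𝔖 : DivisorSupportData' 𝔓) (hc : CuspPreserved 𝔓 Ψ ι e)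
    (hP : ∀ x, ThetaFrobenioid.gpMap (psiPhi 𝔉 Ψ ι e).toMonoidHom x ∈ 𝔖.principal ↔ x ∈ 𝔖.principal)
    (hAdj : AdjacencyCriterion' 𝔖) : PreservesNcspLabels 𝔓 Ψ ι e hc :=
  preservesNcspLabels_of_adjacency 𝔓 Ψ ι e hc fun 𝔭 𝔮 h𝔭 h𝔮 h =>
    adjacency_preserved_of_criterion' Ψ ι e 𝔖 hc hP hAdj 𝔭 𝔮 h𝔭 h𝔮 h

/-- **[EtTh] Proposition 5.3 (iv) over the repaired data**, modulo (i) on primes, F1-Ψ and the printed description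
of the surjection (`CspToNcspWitnessed'`, `CspToNcspCriterion'`).
[cite: MochizukiEtTh2009, Prop 5.3 (iv) p.325 (PDF p.99); proof p.326 (PDF p.100)] -/
theorem preservesCspToNcsp_of_criterion' (𝔖 : DivisorSupportData' 𝔓) (hc : CuspPreserved 𝔓 Ψ ι e)
    (hP : ∀ x, ThetaFrobenioid.gpMap (psiPhi 𝔉 Ψ ι e).toMonoidHom x ∈ 𝔖.principal ↔ x ∈ 𝔖.principal)
    (hW : CspToNcspWitnessed' 𝔖) (hCrit : CspToNcspCriterion' 𝔖) : PreservesCspToNcsp 𝔓 Ψ ι e hc := by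
  intro 𝔞 h𝔞
  set ψ := psiPhi 𝔉 Ψ ι e with hψ
  obtain ⟨𝔫, h𝔫, a, b, n, ha, hn, hbc, hab, hmin, hlin⟩ := hW 𝔞 h𝔞
  have h0 : 𝔓.cspToNcsp ⟨𝔞, h𝔞⟩ = ⟨𝔫, h𝔫⟩ := hCrit 𝔞 𝔫 h𝔞 h𝔫 a b n ha hn hbc hab hmin hlin
  have h𝔞' : 𝔓.IsCuspidal (Primes.congr ψ 𝔞) := (hc 𝔞).mpr h𝔞
  have h𝔫' : ¬ 𝔓.IsCuspidal (Primes.congr ψ 𝔫) := fun h => h𝔫 ((hc 𝔫).mp h)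
  have hg : ∀ x : 𝔉.PhiAcirc, Algebra.GrothendieckGroup.of (ψ x) =
      ThetaFrobenioid.gpMap ψ.toMonoidHom (Algebra.GrothendieckGroup.of x) := fun x => by
    rw [ThetaFrobenioid.gpMap_of, MulEquiv.coe_toMonoidHom]
  have hgba : Algebra.GrothendieckGroup.of (ψ b) * (Algebra.GrothendieckGroup.of (ψ a))⁻¹ =
      ThetaFrobenioid.gpMap ψ.toMonoidHom
        (Algebra.GrothendieckGroup.of b * (Algebra.GrothendieckGroup.of a)⁻¹) := by
    rw [map_mul, map_inv, hg a, hg b]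
  have h1 : 𝔓.cspToNcsp ⟨Primes.congr ψ 𝔞, h𝔞'⟩ = ⟨Primes.congr ψ 𝔫, h𝔫'⟩ := by
    refine hCrit _ _ h𝔞' h𝔫' (ψ a) (ψ b) (ψ n) (DivisorSupportData.map_mem_carrier_congr ψ ha)
      (DivisorSupportData.map_mem_carrier_congr ψ hn) ?_ ?_ ?_ ?_
    · change IsCuspidalGpOf' 𝔓 𝔖.factor _
      rw [hg b]; exact (𝔖.isCuspidalGp_gpMap_iff' ψ hc _).mpr hbc
    · rw [hg a, hg b]; exact (𝔖.coprime_gpMap_iff' ψ _ _).mpr hab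
    · rw [hgba]; exact (𝔖.isCuspidallyMinimal_gpMap_iff' ψ hc hP _).mpr hmin
    · rw [hgba, hg n]; exact (𝔖.linEquiv_gpMap_iff' ψ hP _ _).mpr hlin
  have e1 : (𝔓.cspToNcsp ⟨Primes.congr ψ 𝔞, (hc 𝔞).mpr h𝔞⟩ : Primes 𝔉.PhiAcirc) = Primes.congr ψ 𝔫 :=
    congrArg Subtype.val h1
  have e0 : (𝔓.cspToNcsp ⟨𝔞, h𝔞⟩ : Primes 𝔉.PhiAcirc) = 𝔫 := congrArg Subtype.val h0
  rw [e1, e0]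

end Prop53R

end FrobenioidThetaDivisors

end Literature.AnabelianGeometry.EtaleTheta
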